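import Summits.Langlands.Langlands.Theorems.PicardMuOrdinaryMuOrdinaryFamilyRTThorneWeightReduction
import Summits.Langlands.Langlands.Theorems.PicardMuOrdinaryMuOrdinaryFamilyRTSplit
import HarnessLib

/-!
# Crux `MuOrdinaryFamilyRT` (stmt-Langlands-13757), line `thorne-minimal-lift`: child A of the route-level split from the
# v5 stubs (companion of `…ThorneWeightReduction` p159438 and `…Split` p158597)

The landed split (`Split.rtMuOrdinaryMinimal_of_thorneStubs`, p158597) derives child A `RTMuOrdinaryMinimal` from the v4 stubs
`T.stub_minimalFamily`, `T.stub_finiteOverWeights`, `T.stub_companions`, `T.stub_thorneLift` and the descent facts.  Skeleton v5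
of the line folded the weight data into the family stub (`T.stub_minimalFamilyW`) and relativised the companions stub
(`T.stub_companionsW`, derived from MF1 + MF2 + G1 alone).  This file (proofs only) gives the v5 form of child A:

* `rtMuOrdinaryMinimal_of_plusW : T.stub_minimalFamilyW → T.stub_definiteHostPlusW → S.stub_quadraticDescent → RTMuOrdinaryMinimal`
  (as `Split.rtMuOrdinaryMinimal_of_plus`, with the weight data of the family witness threaded to the relativised K1⁺);
* `rtMuOrdinaryMinimal_of_thorneStubsW : T.stub_minimalFamilyW → T.stub_finiteOverWeights → T.stub_companionsW → T.stub_thorneLift →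
  S.stub_descentFacts → RTMuOrdinaryMinimal` (registered on the crux item) — child A = the live line's exact deliverable, with NO remainder
  stub and NO Picard existence fact.
-/

set_option linter.dupNamespace false

namespace Summit.Langlands.Langlands.Cruxes.MuOrdinaryFamilyRT.ThorneMinimalLift

open scoped NumberField Polynomial Matrix Classical
open Field IsDedekindDomain Polynomial
open Literature.NumberTheory.GaloisRepresentations Literature.NumberTheory.Automorphic
open Summit.Langlands.Langlands.Cruxes.MuOrdinaryFamilyRT.CharZeroDominance
open Summit.Langlands.Langlands.Cruxes.MuOrdinaryFamilyRT.Split (RTMuOrdinaryMinimal)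

noncomputable section

/-- **Child A WITHOUT remainder and WITHOUT the Picard fact, from the v5 family stub** (proof of the landed
`Split.rtMuOrdinaryMinimal_of_plus` run with `T.stub_minimalFamilyW` / `T.stub_definiteHostPlusW`: the witness family carries its weight
data to the relativised K1⁺; then dominance → accumulation (`stub_accumulation`, landed) → quadratic descent → dictionary
(`stub_dictionary`, landed)). -/
theorem rtMuOrdinaryMinimal_of_plusW :
    T.stub_minimalFamilyW → T.stub_definiteHostPlusW → S.stub_quadraticDescent → RTMuOrdinaryMinimal := by
  intro h₂ h₃ h₅ f hcpt hdeg hsep hgal hatt hres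
  have h₄ : S.stub_accumulation := stub_accumulation
  have h₆ : S.stub_dictionary := stub_dictionary
  have hgen : Generic f := ⟨hdeg, hsep, hgal⟩
  obtain ⟨ι, e, S₀, ρC, hin, hM⟩ := hatt
  have hS₀ : ∀ v : HeightOneSpectrum (𝓞 K), ((3 : ℕ) : 𝓞 K) ∈ v.asIdeal → v ∈ S₀ := hin.1
  have htr := hin.2.2
  obtain ⟨𝓕, hdim, hpur, hΛ, hW⟩ := h₂ f ι e S₀ ρC hgen hin hM
  obtain ⟨hfin, F', _instF, _instNF, _instA, hcpt', S', D, E, hdegF', hE, hS', hDint, hDacc,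
      hclass⟩ := h₃ f ι e S₀ ρC 𝓕 hgen hin hM hdim hpur hΛ hW
  haveI : Module.Finite 𝓕.Λ 𝓕.R := hfin
  have hinj : Function.Injective (algebraMap 𝓕.Λ 𝓕.R) :=
    algebraMap_injective_of_ringKrullDim_le 𝓕.dim_le hdim
  let xq : 𝓕.R →+* PadicAlgCl 3 := 𝓕.j.comp (𝓕.x : 𝓕.R →+* 𝓕.𝒪)
  have hxq : ∀ r, xq r = 𝓕.j (𝓕.x r) := fun r => rfl
  have hdom : ∃ 𝔮 : Ideal 𝓕.R, 𝔮.IsPrime ∧ Ideal.comap (algebraMap 𝓕.Λ 𝓕.R) 𝔮 = ⊥ ∧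
      ∀ r ∈ 𝔮, xq r = 0 := by
    refine ⟨⊥, Ideal.isPrime_bot, ?_, fun r hr => ?_⟩
    · rw [← RingHom.ker_eq_comap_bot]
      exact (RingHom.injective_iff_ker_eq_bot _).mp hinj
    · rw [Ideal.mem_bot] at hr
      rw [hr, map_zero]
  have hxint : ∀ a : 𝓕.Λ, ‖xq (algebraMap 𝓕.Λ 𝓕.R a)‖ ≤ 1 := fun a => by
    rw [hxq]; exact 𝓕.j_norm_le _
  have hDacc' : ∀ M : ℕ, ∃ κ ∈ D, ∀ a : 𝓕.Λ,
      ‖κ a - xq (algebraMap 𝓕.Λ 𝓕.R a)‖ ≤ ((3 : ℝ)⁻¹) ^ M := by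
    intro M
    obtain ⟨κ, hκ, h⟩ := hDacc M
    exact ⟨κ, hκ, fun a => by rw [hxq]; exact h a⟩
  obtain ⟨S, hdesc⟩ := h₅ F' hdegF' hcpt hcpt' ι S'
  obtain ⟨𝔐, h𝔐max, h𝔐3, hdict⟩ := h₆ ι e
  refine ⟨e, 𝔐, S ∪ S₀, h𝔐max, h𝔐3, fun k => ?_⟩
  obtain ⟨y, hyD, hyx⟩ := h₄ 𝓕.Λ 𝓕.R xq D E hE hdom hxint hDint hDacc' k
  obtain ⟨ρy, hρyT, hρyirr, P', hP'reg, hP'⟩ := hclass y hyD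
  obtain ⟨P, hPreg, hP⟩ := hdesc ρy P' hρyirr hP'reg hP'
  refine ⟨P, hPreg, fun 𝔭 h𝔭 => ?_⟩
  have h𝔭S : 𝔭 ∉ S := fun h => h𝔭 (Finset.mem_union_left _ h)
  have h𝔭S₀ : 𝔭 ∉ S₀ := fun h => h𝔭 (Finset.mem_union_right _ h)
  have h3 : ((3 : ℕ) : 𝓞 K) ∉ 𝔭.asIdeal := fun h => h𝔭S₀ (hS₀ 𝔭 h)
  obtain ⟨⟨α, t₀, hα, ht₀⟩, hcompat⟩ := hP 𝔭 h𝔭S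
  have happrox : ∀ g, ‖FramedRep.trace ρy g - FramedRep.trace ρC g‖ ≤ ((3 : ℝ)⁻¹) ^ k := by
    intro g
    rw [hρyT g, ← 𝓕.x_trace g, ← hxq]
    exact hyx _
  obtain ⟨t, u, ht, hu, hut⟩ :=
    hdict k f ρC ρy 𝔭 α t₀ h3 (htr 𝔭 h𝔭S₀) ((hcompat h3) α hα).2 ht₀ happrox
  exact ⟨α, t, u, hα, ht, hu, hut⟩

/-- **Child A from the real stubs of skeleton v5 + the descent facts** (K1⁺ through the landed `definiteHostPlusW_of`; quadratic descent
through the landed conditional `stub_quadraticDescent_of` and the tree's theorem `exists_twist_quadraticSign_holds`).  No remainder stub, no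
Picard existence fact. -/
theorem rtMuOrdinaryMinimal_of_thorneStubsW : T.stub_minimalFamilyW → T.stub_finiteOverWeights → T.stub_companionsW → T.stub_thorneLift → S.stub_descentFacts → RTMuOrdinaryMinimal :=
  fun h₁ h₂ h₃ h₄ h₆ =>
    rtMuOrdinaryMinimal_of_plusW h₁ (definiteHostPlusW_of h₂ h₃ h₄)
      (stub_quadraticDescent_of h₆.1 h₆.2.1 Literature.NumberTheory.Automorphic.exists_twist_quadraticSign_holds
        h₆.2.2.1 h₆.2.2.2.1 h₆.2.2.2.2)

end

end Summit.Langlands.Langlands.Cruxes.MuOrdinaryFamilyRT.ThorneMinimalLift
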